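import Literature.NumberTheory.EllipticCurves.SzpiroNumberFieldMinimalityProofs
import HarnessLib

/-!
# `abc ⟹ Szpiro` over a number field, IIb: the local inequality in the degenerate case `j ∈ {0, 1728}`

Companion PROOF file (theorems only) of `Literature.NumberTheory.EllipticCurves.Szpiro`, sibling of
`SzpiroNumberFieldLocalProofs`: when `c₄ = 0` or `c₆ = 0` the point `x = c₄³/(1728Δ)` of
`ℙ¹ ∖ {0,1,∞}` degenerates, but then the minimal discriminant exponent at every finite place `v` is
bounded outright by minimality (Silverman AEC VII.1 Rmk 1.1 / Ex. 8.21: `2 ord c₆ = ord 1728 + ord Δ`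
resp. `3 ord c₄ = ord 1728 + ord Δ` on the local minimal model, and `ord c₆ < 6 ord 6 + 6` resp.
`ord c₄ < 4 ord 6 + 4`), the reduction being good or additive (`f_v ≥ 2`):
`WeierstrassCurve.szpiro_local_ineq_degenerate`: `d·L ≤ 6 f·L + 6 c_v·L` with `c_v = 0` for `v ∤ 6`
and `c_v = 3 ord_v 1728 + 5` otherwise.

## References

* J. H. Silverman, *The Arithmetic of Elliptic Curves*, GTM 106, 2nd ed. 2009, VII.1, VII.5.1,
  VIII.11 and Ex. 8.21. [SilvermanAEC2009]
-/

open IsDedekindDomain NumberField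

namespace WeierstrassCurve

open Literature.NumberTheory.EllipticCurves.SzpiroLocal

section Helpers

variable {K : Type*} [Field K] [NumberField K] (v : HeightOneSpectrum (𝓞 K))

/-- `(exp k)^n = exp (n k)` in `ℤᵐ⁰`. [folklore] -/
private theorem withZero_exp_pow (k : ℤ) (n : ℕ) :
    WithZero.exp k ^ n = WithZero.exp ((n : ℤ) * k) := by
  rw [← WithZero.exp_nsmul, nsmul_eq_mul]

/-- The residue field of `O_v` is perfect (it is finite). [folklore] -/
private theorem perfectField_residueField_adicCompletionIntegers' : PerfectField
    (IsLocalRing.ResidueField (v.adicCompletionIntegers K)) := by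
  haveI := v.isMaximal
  exact PerfectField.ofFinite

end Helpers

section LocalIneq

variable {K : Type*} [Field K] [NumberField K] (v : HeightOneSpectrum (𝓞 K))
  (W : WeierstrassCurve K) [W.IsElliptic]

/-- **Local Szpiro inequality, degenerate case `c₄ = 0` or `c₆ = 0`** (`j = 0` or `j = 1728`): the
minimal discriminant exponent is then bounded outright, `d·L ≤ 6f·L + 6c·L` with the same `c` as in
`szpiro_local_ineq` (additive or good reduction only; minimality bounds `ord c₆` resp. `ord c₄`).
[cite: SilvermanAEC2009, VII.1 Remark 1.1 and Ex. 8.21] -/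
theorem szpiro_local_ineq_degenerate (h0 : W.c₄ = 0 ∨ W.c₆ = 0) (t₂ t₃ : ℕ)
    (ht₂ : v.valuation K (2 : K) = WithZero.exp (-(t₂ : ℤ)))
    (ht₃ : v.valuation K (3 : K) = WithZero.exp (-(t₃ : ℤ))) :
    (W.ordMinimalDiscriminant v : ℝ) * Real.log (Ideal.absNorm v.asIdeal)
      ≤ 6 * (W.conductorExponent v : ℝ) * Real.log (Ideal.absNorm v.asIdeal)
        + 6 * (if t₂ + t₃ = 0 then (0 : ℝ) else 3 * (6 * t₂ + 3 * t₃) + 5) *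
          Real.log (Ideal.absNorm v.asIdeal) := by
  classical
  haveI := perfectField_residueField_adicCompletionIntegers' v
  set M := W.localMinimalIntegralModel v with hM
  have hMΔ : M.Δ ≠ 0 := localMinimalIntegralModel_Δ_ne_zero v W
  obtain ⟨E, hE⟩ := exists_localMinimalModel_eq_smul v W
  have hc4 : (M.c₄ : v.adicCompletion K) = (W.localMinimalModel v).c₄ := by
    rw [hM, ← baseChange_localMinimalIntegralModel v W]; simp [baseChange, map_c₄]
  have hc6 : (M.c₆ : v.adicCompletion K) = (W.localMinimalModel v).c₆ := by
    rw [hM, ← baseChange_localMinimalIntegralModel v W]; simp [baseChange, map_c₆]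
  obtain ⟨d, hdM, hd⟩ :=
    IsDedekindDomain.HeightOneSpectrum.exists_addVal_adicCompletionIntegers_eq K v M.Δ hMΔ
  have hdord : W.ordMinimalDiscriminant v = d := by
    change (IsDiscreteValuationRing.addVal (v.adicCompletionIntegers K) M.Δ).toNat = d
    rw [hdM]; rfl
  have h2v : Valued.v (2 : v.adicCompletion K) = WithZero.exp (-(t₂ : ℤ)) := by
    have h := valued_algebraMap_adicCompletion v (2 : K)
    rwa [map_ofNat, ht₂] at h
  have h3v : Valued.v (3 : v.adicCompletion K) = WithZero.exp (-(t₃ : ℤ)) := by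
    have h := valued_algebraMap_adicCompletion v (3 : K)
    rwa [map_ofNat, ht₃] at h
  have h1728 : Valued.v (1728 : v.adicCompletion K) =
      WithZero.exp (-((6 * t₂ + 3 * t₃ : ℕ) : ℤ)) := by
    rw [show (1728 : v.adicCompletion K) = 2 ^ 6 * 3 ^ 3 by norm_num, map_mul, map_pow, map_pow,
      h2v, h3v, withZero_exp_pow, withZero_exp_pow, ← WithZero.exp_add]
    congr 1; push_cast; ring
  have h6v : Valued.v ((6 : v.adicCompletionIntegers K) : v.adicCompletion K) =
      WithZero.exp (-((t₂ + t₃ : ℕ) : ℤ)) := by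
    rw [show ((6 : v.adicCompletionIntegers K) : v.adicCompletion K) = (6 : v.adicCompletion K)
      from map_ofNat (algebraMap (v.adicCompletionIntegers K) (v.adicCompletion K)) 6,
      show (6 : v.adicCompletion K) = 2 * 3 by norm_num, map_mul, h2v, h3v, ← WithZero.exp_add]
    congr 1; push_cast; ring
  have hrel : (1728 : v.adicCompletion K) * (M.Δ : v.adicCompletion K) =
      (M.c₄ : v.adicCompletion K) ^ 3 - (M.c₆ : v.adicCompletion K) ^ 2 := by
    have := congrArg (fun r : v.adicCompletionIntegers K => (r : v.adicCompletion K)) M.c_relation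
    push_cast at this
    exact this
  have hVD : Valued.v ((1728 : v.adicCompletion K) * (M.Δ : v.adicCompletion K)) =
      WithZero.exp (-((6 * t₂ + 3 * t₃ + d : ℕ) : ℤ)) := by
    rw [map_mul, h1728, hd, ← WithZero.exp_add]; congr 1; push_cast; ring
  have hmem_iff : ∀ r : v.adicCompletionIntegers K, r ≠ 0 → ∀ n : ℕ,
      Valued.v (r : v.adicCompletion K) = WithZero.exp (-(n : ℤ)) →
      (r ∈ IsLocalRing.maximalIdeal (v.adicCompletionIntegers K) ↔ 0 < n) := by
    intro r hr n hn
    rw [IsLocalRing.mem_maximalIdeal, mem_nonunits_iff,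
      IsDedekindDomain.HeightOneSpectrum.adicCompletionIntegers.isUnit_iff_valued_eq_one, hn,
      ← WithZero.exp_zero, WithZero.exp_inj]
    omega
  have hL : 0 ≤ Real.log (Ideal.absNorm v.asIdeal) :=
    Real.log_nonneg (by exact_mod_cast (NumberField.HeightOneSpectrum.one_lt_absNorm v).le)
  -- the integer inequality `d ≤ 6 f + 6 c`
  have hint : (d : ℤ) ≤ 6 * (W.conductorExponent v : ℕ) +
      6 * (if t₂ + t₃ = 0 then (0 : ℤ) else 3 * (6 * t₂ + 3 * t₃) + 5) := by
    rcases h0 with h4 | h6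
    · -- `c₄ = 0`: then `c₄(M) = 0`, `c₆(M)² = -1728 Δ(M)`, `2 ord c₆ = t + d`, `ord c₆ < 6 t₆ + 6`
      have hM4 : M.c₄ = 0 := by
        have h : (M.c₄ : v.adicCompletion K) = 0 := by
          rw [hc4, hE, variableChange_c₄]; simp [baseChange, map_c₄, h4]
        exact_mod_cast h
      have hM6 : M.c₆ ≠ 0 := by
        intro h
        apply hMΔ
        have hz : (1728 : v.adicCompletion K) * (M.Δ : v.adicCompletion K) = 0 := by
          rw [hrel, hM4, h]; simp
        have h1728 : (1728 : v.adicCompletion K) ≠ 0 := by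
          rw [← map_ofNat (algebraMap K (v.adicCompletion K)) 1728]
          exact (_root_.map_ne_zero _).mpr (by norm_num)
        exact_mod_cast (mul_eq_zero.mp hz).resolve_left h1728
      obtain ⟨b, hbM, hb⟩ :=
        IsDedekindDomain.HeightOneSpectrum.exists_addVal_adicCompletionIntegers_eq K v M.c₆ hM6
      have h2b : 2 * b = 6 * t₂ + 3 * t₃ + d := by
        have h := congrArg Valued.v hrel
        rw [hVD, hM4] at h
        push_cast at h
        rw [zero_pow three_ne_zero, zero_sub, Valuation.map_neg, map_pow, hb, withZero_exp_pow,
          WithZero.exp_inj] at h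
        omega
      have hmin : 4 * (t₂ + t₃) + 4 < 4 * (t₂ + t₃) + 4 ∨ b < 6 * (t₂ + t₃) + 6 :=
        localMinimal_ord_c₄_c₆_lt v W (4 * (t₂ + t₃) + 4) b (t₂ + t₃)
          (by rw [← hM, hM4]; simp) (hM ▸ hb.le) h6v
      have hb' : b < 6 * (t₂ + t₃) + 6 := by omega
      rcases hasGoodReductionAt_or_hasMultiplicativeReductionAt_or_hasAdditiveReductionAt v W with
        hg | hm | hadd
      · have hd0 : d = 0 := hdord ▸ (ordMinimalDiscriminant_eq_zero_iff_holds v W).mpr hg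
        split_ifs <;> omega
      · obtain ⟨-, hc4m⟩ := (hasMultiplicativeReductionAt_iff_mem v W).mp hm
        exact absurd (by rw [← hM, hM4]; exact Ideal.zero_mem _) hc4m
      · have hf := (two_le_conductorExponent_iff_holds v W).mpr hadd
        split_ifs <;> omega
    · -- `c₆ = 0`: then `c₆(M) = 0`, `c₄(M)³ = 1728 Δ(M)`, `3 ord c₄ = t + d`, `ord c₄ < 4 t₆ + 4`
      have hM6 : M.c₆ = 0 := by
        have h : (M.c₆ : v.adicCompletion K) = 0 := by
          rw [hc6, hE, variableChange_c₆]; simp [baseChange, map_c₆, h6]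
        exact_mod_cast h
      have hM4 : M.c₄ ≠ 0 := by
        intro h
        apply hMΔ
        have hz : (1728 : v.adicCompletion K) * (M.Δ : v.adicCompletion K) = 0 := by
          rw [hrel, hM6, h]; simp
        have h1728 : (1728 : v.adicCompletion K) ≠ 0 := by
          rw [← map_ofNat (algebraMap K (v.adicCompletion K)) 1728]
          exact (_root_.map_ne_zero _).mpr (by norm_num)
        exact_mod_cast (mul_eq_zero.mp hz).resolve_left h1728
      obtain ⟨a, haM, ha⟩ :=
        IsDedekindDomain.HeightOneSpectrum.exists_addVal_adicCompletionIntegers_eq K v M.c₄ hM4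
      have h3a : 3 * a = 6 * t₂ + 3 * t₃ + d := by
        have h := congrArg Valued.v hrel
        rw [hVD, hM6] at h
        push_cast at h
        rw [zero_pow two_ne_zero, sub_zero, map_pow, ha, withZero_exp_pow, WithZero.exp_inj] at h
        omega
      have hmin : a < 4 * (t₂ + t₃) + 4 ∨ 6 * (t₂ + t₃) + 6 < 6 * (t₂ + t₃) + 6 :=
        localMinimal_ord_c₄_c₆_lt v W a (6 * (t₂ + t₃) + 6) (t₂ + t₃)
          (hM ▸ ha.le) (by rw [← hM, hM6]; simp) h6v
      have ha' : a < 4 * (t₂ + t₃) + 4 := by omega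
      rcases hasGoodReductionAt_or_hasMultiplicativeReductionAt_or_hasAdditiveReductionAt v W with
        hg | hm | hadd
      · have hd0 : d = 0 := hdord ▸ (ordMinimalDiscriminant_eq_zero_iff_holds v W).mpr hg
        split_ifs <;> omega
      · obtain ⟨hΔm, hc4m⟩ := (hasMultiplicativeReductionAt_iff_mem v W).mp hm
        have ha0 : a = 0 := by
          have := (hmem_iff M.c₄ hM4 a ha).not.mp hc4m
          omega
        have hd0 : 0 < d := (hmem_iff M.Δ hMΔ d hd).mp hΔm
        omega
      · have hf := (two_le_conductorExponent_iff_holds v W).mpr hadd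
        split_ifs <;> omega
  rw [hdord]
  have key := mul_le_mul_of_nonneg_right (Int.cast_le (R := ℝ).mpr hint) hL
  push_cast at key ⊢
  linarith [key]

end LocalIneq

end WeierstrassCurve
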